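import Summits.AtomisticToContinuum.Crystallization.Theorems.FrustratedLawDichotomyAveragingRuleCertFormat

/-!
# FrustratedLawDichotomy · THE HEDGEHOG: ball-averaged pricing at ONE SHELL (`ρ = 23/20`) is FALSE for `7/10`-separated clusters

A legal but unphysical adversary that the live radius of lens-5 g35's door `D_AVG` (critic row 518 (3): `ρ = 1.15`) does not survive.  The
hard core of the column is `7/10`, far below the Lennard-Jones distance `1`: a LOOSE centre (no neighbour within `ρ = 23/20`) may carry an
OVER-PACKED shell just outside `ρ`.  `hedgehog` = the origin plus `32` atoms at distance exactly `7/6` in the directions of the icosahedron and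
the dodecahedron (rounded to rational points of the sphere, integer table `hedgehogTable` on the sphere of radius `28249`), pairwise `≥ 0.711`
apart (`sep_hedgehog`, by `decide` on the integer table).  The centre's `23/20`-ball is the singleton `{centre}` (`ball_hedgehog_centre`), the centre
fits no kissing dozen (`not_goodAt_hedgehog_centre`: all `32` shell atoms sit at the nearest-neighbour distance, a `12`-point pattern cannot cover them),
and its half site energy is `16·W₄₅(7/6) = −0.8496…` (`W₄₅(7/6) = V_LJ(7/6) − (3/200)·ω₂(35/24)`, exact rational), below every level of the column:

* ★ `not_tightFreeDefectPricing_oneShell` — lens-5 g35's piece `F2 = TightFreeDefectPricing W₄₅ e₄₅ (23/20)` is FALSE (`S_c(0) ≤ −0.149`);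
* ★ `not_ballAveragedPricing_oneShell` — hence `LAP_{23/20} = BallAveragedPricing (23/20) (1/20) (1/8) W₄₅ e₄₅ (1/100) C_T` is FALSE for EVERY `C_T`
  (the door `D_AVG` is SHUT at one shell, not only below `7/10`);
* ★ `not_tightFreeMotifPricingCapAt_zero_oneShell` — the one-shell members of hand-2 g13's own families are unsatisfiable hypotheses
  (`TightFreeMotifPricingCapAt 0 (23/20) ϱ D W₄₅ (−0.7174 + 3/400)` for every `ϱ ≥ 7/6`, every `D`): the literal `…_oneShell` theorems of
  `…AveragingRuleCap/TightFree/Unsplit/CertFormat` are TRUE BUT VACUOUS; the dial must start higher.  Back-of-envelope (memo): the same attack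
  yields `½·siteE ≳ −0.58` at `ρ = 3/2` and `≈ −0.14` at `ρ = 21/10` against the level `−0.71`, so `ρ ≥ 3/2` survives THIS adversary —
  the `…Shells` literals (`ρ ∈ {3/2, 21/10, 13/5}`) are the live ones.

[folklore] explicit counterexample; 0 sorry.  Prover hand 2, gen 13 (decomp-a2c), `--supports stmt-AtomisticToContinuum-27623`.
-/

noncomputable section

namespace Summit.AtomisticToContinuum.Crystallization.Theorems.FrustratedLawDichotomyHedgehog

open scoped BigOperators Classical
open Literature.Geometry.DiscreteGeometry (intVec sqNormInt norm_intVec intVec_sub fccKissingPattern hcpKissingPattern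
  card_fccKissingPattern card_hcpKissingPattern)
open Literature.MathematicalPhysics.StatisticalMechanics (siteEnergy lennardJones)
open Summit.AtomisticToContinuum.Crystallization.Theorems.ChargedEnergyGapNegative (E3)
open Summit.AtomisticToContinuum.Crystallization.Theorems.FrustratedLawDichotomyRangeCut
open Summit.AtomisticToContinuum.Crystallization.Theorems.FrustratedLawDichotomySchurCut
open Summit.AtomisticToContinuum.Crystallization.Theorems.FrustratedLawDichotomyMotifLemmas
open Summit.AtomisticToContinuum.Crystallization.Theorems.FrustratedLawDichotomyRuleToolkitGood
open Summit.AtomisticToContinuum.Crystallization.Theorems.FrustratedLawDichotomyAveragingCut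
  (surplus ball ballAvg mem_ball BallAveragedPricing TightNear BadNear TightFreeDefectPricing xS)
open Summit.AtomisticToContinuum.Crystallization.Theorems.FrustratedLawDichotomyAveragingRuleCap
open Summit.AtomisticToContinuum.Crystallization.Theorems.FrustratedLawDichotomyAveragingRuleTightFree
open Summit.AtomisticToContinuum.Crystallization.Theorems.FrustratedLawDichotomyAveragingRuleUnsplit
open Summit.AtomisticToContinuum.Crystallization.Theorems.FrustratedLawDichotomyAveragingRuleCertFormat

/-! ## §1. The integer table and its two `decide` facts -/

/-- The hedgehog's integer table: row `0` the centre, rows `1…32` the icosahedral + dodecahedral directions as integer points of the sphere of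
radius `28249 = 13·41·53`. -/
def hedgehogTable : Fin 33 → Fin 3 → ℤ :=
  ![![0, 0, 0], ![0, 14924, 23985], ![14924, 23985, 0], ![23985, 0, 14924], ![0, 14924, -23985], ![14924, -23985, 0], ![-23985, 0, 14924], ![0, -14924, 23985], ![-14924, 23985, 0], ![23985, 0, -14924], ![0, -14924, -23985], ![-14924, -23985, 0], ![-23985, 0, -14924], ![16536, 16536, 15847], ![0, 26076, 10865], ![10865, 0, 26076], ![-10865, 0, 26076], ![-16536, 15847, 16536], ![26076, 10865, 0], ![0, 26076, -10865], ![16536, 15847, -16536], ![15847, -16536, 16536], ![26076, -10865, 0], ![-16536, 15847, -16536], ![10865, 0, -26076], ![-10865, 0, -26076], ![0, -26076, 10865], ![15847, -16536, -16536], ![0, -26076, -10865], ![-16536, -16536, 15847], ![-26076, 10865, 0], ![-26076, -10865, 0], ![-16536, -15847, -16536]]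

/-- Every shell row lies on the sphere of radius `28249`. [folklore] -/
theorem table_sqNorm : ∀ a : Fin 33, a ≠ 0 → sqNormInt (hedgehogTable a) = 28249 ^ 2 := by
  decide

/-- Pairwise separation in the table: `25·|T a − T b|² ≥ 9·28249²` (i.e. chord `≥ 7/10` after scaling to radius `7/6`). [folklore] -/
theorem table_sep : ∀ a b : Fin 33, a ≠ b → 9 * 28249 ^ 2 ≤ 25 * sqNormInt (hedgehogTable a - hedgehogTable b) := by
  decide

/-- The centre row is zero. [folklore] -/
theorem table_zero : hedgehogTable 0 = 0 := by
  decide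

/-! ## §2. The configuration -/

/-- **The hedgehog**: `33` atoms, `y a = (7/(6·28249)) · T a`. -/
def hedgehog : Fin 33 → E3 := fun a => (7 / (6 * 28249) : ℝ) • intVec (hedgehogTable a)

/-- Distances in the hedgehog from the integer table. [folklore] -/
theorem dist_hedgehog (a b : Fin 33) :
    dist (hedgehog a) (hedgehog b) = 7 / (6 * 28249) * Real.sqrt (sqNormInt (hedgehogTable a - hedgehogTable b) : ℝ) := by
  unfold hedgehog
  rw [dist_eq_norm, ← smul_sub, intVec_sub, norm_smul, norm_intVec, Real.norm_of_nonneg (by norm_num)]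

/-- Every shell atom sits at distance exactly `7/6` from the centre. [folklore] -/
theorem dist_hedgehog_zero {a : Fin 33} (ha : a ≠ 0) : dist (hedgehog a) (hedgehog 0) = 7 / 6 := by
  rw [dist_hedgehog, table_zero, sub_zero, table_sqNorm a ha]
  have hc : ((28249 ^ 2 : ℤ) : ℝ) = (28249 : ℝ) ^ 2 := by push_cast; ring
  rw [hc, Real.sqrt_sq (by norm_num)]
  norm_num

/-- The hedgehog is `7/10`-separated. [folklore] -/
theorem sep_hedgehog : Sep hedgehog := by
  intro a b hab
  rw [dist_hedgehog]
  have h := table_sep a b hab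
  have h' : ((9 * 28249 ^ 2 : ℤ) : ℝ) ≤ ((25 * sqNormInt (hedgehogTable a - hedgehogTable b) : ℤ) : ℝ) := by exact_mod_cast h
  push_cast at h'
  have hs : (3 * 28249 / 5 : ℝ) ≤ Real.sqrt (sqNormInt (hedgehogTable a - hedgehogTable b) : ℝ) := by
    rw [show (3 * 28249 / 5 : ℝ) = Real.sqrt ((3 * 28249 / 5) ^ 2) by rw [Real.sqrt_sq (by norm_num)]]
    exact Real.sqrt_le_sqrt (by nlinarith)
  have : (7 : ℝ) / 10 = 7 / (6 * 28249) * (3 * 28249 / 5) := by norm_num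
  rw [this]
  exact mul_le_mul_of_nonneg_left hs (by norm_num)

/-- The hedgehog is injective. [folklore] -/
theorem hedgehog_injective : Function.Injective hedgehog := by
  intro a b h
  by_contra hab
  have := sep_hedgehog a b hab
  rw [h, dist_self] at this
  norm_num at this

/-- The centre's `23/20`-ball is the singleton `{centre}`. [folklore] -/
theorem ball_hedgehog_centre : ball (23 / 20) hedgehog 0 = {0} := by
  ext k
  rw [mem_ball, Finset.mem_singleton]
  constructor
  · intro h
    by_contra hk
    rw [dist_hedgehog_zero hk] at h
    norm_num at h
  · rintro rfl
    rw [dist_self]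
    norm_num

/-! ## §3. The centre fits no kissing dozen -/

/-- Thirty-two distinct points cannot all lie in the range of a map from a `12`-element type. [folklore] -/
theorem too_many_for_pattern {P : Type*} [Fintype P] (hP : Fintype.card P = 12) (t : P → E3) {y : Fin 33 → E3}
    (hy : Function.Injective y) (h : ∀ k : Fin 33, k ≠ 0 → y k ∈ Set.range t) : False := by
  have hsub : (Finset.univ.erase (0 : Fin 33)).image y ⊆ Finset.univ.image t := by
    intro p hp
    obtain ⟨k, hk, rfl⟩ := Finset.mem_image.1 hp
    obtain ⟨u, hu⟩ := h k (Finset.ne_of_mem_erase hk)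
    exact Finset.mem_image.2 ⟨u, Finset.mem_univ _, hu⟩
  have h1 : ((Finset.univ.erase (0 : Fin 33)).image y).card = 32 := by
    rw [Finset.card_image_of_injective _ hy, Finset.card_erase_of_mem (Finset.mem_univ _), Finset.card_univ, Fintype.card_fin]
  have h2 : (Finset.univ.image t).card ≤ 12 := Finset.card_image_le.trans (by rw [Finset.card_univ, hP])
  have h3 := Finset.card_le_card hsub
  omega

/-- ★ **The centre of the hedgehog is not `η`-good for any `η`**: all `32` shell atoms sit at the nearest-neighbour distance `7/6`, so the
clean-shell clause would put all of them in the range of the `12`-point pattern map. [folklore] -/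
theorem not_goodAt_hedgehog_centre (η : ℝ) : ¬GoodAt η hedgehog 0 := by
  rintro ⟨d, η', γ, A, hor⟩
  -- the pinning clauses force `d = 7/6`, then the gap clause swallows every shell atom
  have key : ∀ {P : Type} [Fintype P], Fintype.card P = 12 → ∀ (t : P → E3), 0 < γ →
      (∀ s : E3, s ∈ Set.range hedgehog → s ≠ hedgehog 0 → d ≤ dist s (hedgehog 0)) →
      (∃ s : E3, s ∈ Set.range hedgehog ∧ s ≠ hedgehog 0 ∧ dist s (hedgehog 0) ≤ d) →
      (∀ s : E3, s ∈ Set.range hedgehog → s ≠ hedgehog 0 → dist s (hedgehog 0) < 13 / 10 * d + γ →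
        dist s (hedgehog 0) ≤ 13 / 10 * d - γ ∧ s ∈ Set.range t) → False := by
    intro P _ hP t hγ h1 h2 h3
    obtain ⟨s, ⟨k, rfl⟩, hk0, hkd⟩ := h2
    have hk : k ≠ 0 := fun h => hk0 (by rw [h])
    rw [dist_hedgehog_zero hk] at hkd
    refine too_many_for_pattern hP t hedgehog_injective fun j hj => ?_
    have hj0 : hedgehog j ≠ hedgehog 0 := fun h => hj (hedgehog_injective h)
    have hdj := dist_hedgehog_zero hj
    have hle := h1 (hedgehog j) ⟨j, rfl⟩ hj0
    rw [hdj] at hle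
    exact (h3 (hedgehog j) ⟨j, rfl⟩ hj0 (by rw [hdj]; linarith)).2
  rcases hor with ⟨t, -, hγ, -, -, h1, h2, h3⟩ | ⟨t, -, hγ, -, -, h1, h2, h3⟩
  · exact key (by rw [Fintype.card_coe, card_fccKissingPattern]) t hγ h1 h2 h3
  · exact key (by rw [Fintype.card_coe, card_hcpKissingPattern]) t hγ h1 h2 h3

/-! ## §4. The centre's site energy and the three refutations -/

/-- `w₄₅ (7/6) = 0` (the tail weight is off below `3`). [folklore] -/
theorem w₄₅_seven_sixths : w₄₅ (7 / 6) = 0 := by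
  unfold w₄₅ cutWeight smoothstep₁
  norm_num

/-- ★ **`W₄₅(7/6) ≤ −53/1000`** (exact value `V_LJ(7/6) − (3/200)·ω₂(35/24) = −0.05310…`). [folklore] -/
theorem W₄₅_seven_sixths_le : effPot w₄₅ ω₄ (3 / 400) (7 / 6) ≤ -(53 / 1000) := by
  unfold effPot corePot ω₄ omega₂ lennardJones
  rw [w₄₅_seven_sixths]
  norm_num

/-- The centre's site energy is `32·W(7/6)`. [folklore] -/
theorem siteEnergy_hedgehog_centre (W : ℝ → ℝ) : siteEnergy W hedgehog 0 = 32 * W (7 / 6) := by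
  unfold siteEnergy
  rw [Finset.sum_congr rfl fun k hk => by rw [dist_comm, dist_hedgehog_zero (Finset.ne_of_mem_erase hk)], Finset.sum_const,
    Finset.card_erase_of_mem (Finset.mem_univ _), Finset.card_univ, Fintype.card_fin, nsmul_eq_mul]
  norm_num

/-- ★ **lens-5 g35's piece `F2` at one shell is FALSE**: `¬ TightFreeDefectPricing W₄₅ e₄₅ (23/20)`. [folklore] -/
theorem not_tightFreeDefectPricing_oneShell :
    ¬TightFreeDefectPricing (effPot w₄₅ ω₄ (3 / 400)) (-(7175 / 10000) + 3 / 400) (23 / 20) := by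
  intro h
  have hnt : ¬TightNear (23 / 20) hedgehog 0 := by
    rintro ⟨j, hj, hg⟩
    rw [ball_hedgehog_centre, Finset.mem_singleton] at hj
    subst hj
    exact not_goodAt_hedgehog_centre _ hg
  have hb : BadNear (23 / 20) hedgehog 0 :=
    ⟨0, by rw [ball_hedgehog_centre]; exact Finset.mem_singleton_self _, not_goodAt_hedgehog_centre _⟩
  have h0 := h 33 hedgehog hedgehog_injective sep_hedgehog 0 hnt hb
  unfold ballAvg at h0
  rw [ball_hedgehog_centre, Finset.sum_singleton, ball_hedgehog_centre, Finset.card_singleton] at h0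
  simp only [xS, surplus, if_neg (not_goodAt_hedgehog_centre _), siteEnergy_hedgehog_centre, Nat.cast_one, div_one] at h0
  have hW := W₄₅_seven_sixths_le
  linarith

/-- ★ **The door `D_AVG` is SHUT at one shell**: `¬ BallAveragedPricing (23/20) (1/20) (1/8) W₄₅ e₄₅ (1/100) C_T` for every `C_T`. [folklore] -/
theorem not_ballAveragedPricing_oneShell (CT : ℝ) :
    ¬BallAveragedPricing (23 / 20) (1 / 20) (1 / 8) (effPot w₄₅ ω₄ (3 / 400)) (-(7175 / 10000) + 3 / 400) (1 / 100) CT := by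
  intro h
  have h0 := h 33 hedgehog hedgehog_injective sep_hedgehog 0
  unfold ballAvg at h0
  rw [ball_hedgehog_centre, Finset.sum_singleton, ball_hedgehog_centre, Finset.card_singleton] at h0
  simp only [surplus, if_neg (not_goodAt_hedgehog_centre _), siteEnergy_hedgehog_centre, Nat.cast_one, div_one] at h0
  have hW := W₄₅_seven_sixths_le
  linarith

/-- ★ **hand-2 g13's one-shell members are unsatisfiable**: `¬ TightFreeMotifPricingCapAt 0 (23/20) ϱ D W₄₅ (−0.7174 + 3/400)` for every motif
radius `ϱ ≥ 7/6` and every cap `D` (the hedgehog is a radius-`7/6` motif about its centre). [folklore] -/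
theorem not_tightFreeMotifPricingCapAt_zero_oneShell {ϱ D : ℝ} (hϱ : 7 / 6 ≤ ϱ) :
    ¬TightFreeMotifPricingCapAt 0 (23 / 20) ϱ D (effPot w₄₅ ω₄ (3 / 400)) (-(7174 / 10000) + 3 / 400) := by
  intro h
  have hconf : ∀ a : Fin 33, dist (hedgehog a) (hedgehog 0) ≤ ϱ := by
    intro a
    by_cases ha : a = 0
    · rw [ha, dist_self]; linarith
    · rw [dist_hedgehog_zero ha]; exact hϱ
  have hnt : ¬TightNearCap (23 / 20) D hedgehog 0 := by
    rintro ⟨j, hj, hg⟩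
    rw [ball_hedgehog_centre, Finset.mem_singleton] at hj
    subst hj
    exact not_goodAt_hedgehog_centre _ hg.goodAt
  have h0 := h 33 hedgehog hedgehog_injective sep_hedgehog 0 hconf hnt
  rw [ballAvg_surplusCap_zero_zero_eq] at h0
  unfold ballAvg at h0
  rw [ball_hedgehog_centre, Finset.sum_singleton, ball_hedgehog_centre, Finset.card_singleton] at h0
  simp only [siteEnergy_hedgehog_centre, Nat.cast_one, div_one] at h0
  have hW := W₄₅_seven_sixths_le
  linarith

end Summit.AtomisticToContinuum.Crystallization.Theorems.FrustratedLawDichotomyHedgehog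

end
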